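import Summits.Ventures.PercRepro.ProfileFlatUpsetCorankReduction

/-!
# PercRepro — (G) AT THE PRINCIPAL UP-SET OF A TWO-POINT LINE ON `2r − 2` POINTS: THE SWAP INJECTIONS AND THE CLASSES
(p10, gen 20; `proofs/P10-AVFULL.md` §28)

`M` of rank `r` on `N = 2r − 2` points, `F₀ = {e, f}` a flat (a two-point line), `U = principalUp M F₀`.  Every term
of the signed sum is `±1` (`term_eq_of_mem_sepSets_two_mul`, `sum_term_eq_of_subset`).  THE SWAP `Z ↦ (E ∖ Z) ∪ f`
sends a negative `Z ∋ f` with `f ∉ cl (E ∖ Z)` to a positive set (`insert_sdiff_mem_posTwo`) and is injective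
(`eq_of_insert_sdiff_eq`).  THE CLASSES: `negB / posB` and `negD / posD` (the signed parts of the drop module's classes
`(B)`, `(D)` of `e`), `bothL = {Z ⊇ F₀ negative : e, f ∉ cl (E ∖ Z)}` and
`depL = {B ⊇ F₀ positive : e, f ∉ cl (E ∖ B), rk ((E ∖ B) ∪ F₀) = r − 1}`.  THE TWO INJECTIONS: `negB ↪ posD ∪ depL`
(`card_negB_le`) and `bothL ⊔ negD ↪ posB` (`card_bothL_union_negD_le`, `disjoint_bothL_negD`), both by the swap at
`f`; so the spanned class `(B) ∪ (D)` of `e` is non-negative as soon as `#depL ≤ #bothL` (the rank-5 module).  Also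
here: with a coloop `y ∈ F₀` every negative set is in the class `(C)` of `y` and the 114th module's injection applies
(`card_negTwo_le_card_posTwo_of_coloop_mem`).  Census (own code, gen 20): `#pos − #neg = #bothL + #free − #depL`
on every instance at `n = 6, 8`.  Nothing here asserts (G) in general.
-/

open scoped Matroid

namespace PercRepro.Cogirth

open Finset ThmH Skew

variable {α : Type} [DecidableEq α] {M : Matroid α} [M.Finite]

/-! ### Closure and rank helpers -/

/-- A set of rank at most that of a subset lies in the closure of the subset. -/
theorem subset_clF_of_rk_le {X Y : Finset α} (hY : Y ⊆ gr M) (hXY : X ⊆ Y) (hr : rk M Y ≤ rk M X) :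
    Y ⊆ clF M X := by
  intro z hz
  rw [mem_clF_iff_rk_insert_eq (hY hz) (hXY.trans hY)]
  apply le_antisymm
  · have := rk_mono_fu (M := M) (insert_subset hz hXY); omega
  · exact rk_mono_fu (subset_insert _ _)

/-- A coloop `y` is not in the closure of a set avoiding it. -/
theorem notMem_clF_of_coloop {y : α} (hy : y ∈ gr M) (hco : rk M ((gr M).erase y) + 1 = rk M (gr M))
    {X : Finset α} (hX : X ⊆ (gr M).erase y) : y ∉ clF M X := by
  intro h
  have h1 : y ∈ clF M ((gr M).erase y) := clF_mono_fu hX h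
  rw [mem_clF_iff_rk_insert_eq hy (erase_subset _ _), insert_erase hy] at h1
  omega

/-- A coloop of a set is a coloop of every subset containing it. -/
theorem rk_erase_of_coloop_subset {D D' : Finset α} (hD : D ⊆ gr M) (hD' : D' ⊆ D) {x : α} (hx : x ∈ D')
    (hco : rk M (D.erase x) + 1 = rk M D) : rk M (D'.erase x) + 1 = rk M D' := by
  have hxg : x ∈ gr M := hD (hD' hx)
  have hD'g : D' ⊆ gr M := hD'.trans hD
  have h1 : rk M D' ≤ rk M (D'.erase x) + 1 := by
    have h := rk_insert_le (M := M) x (D'.erase x)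
    rw [insert_erase hx] at h
    exact h
  have h2 : rk M (D'.erase x) ≤ rk M D' := rk_mono_fu (erase_subset x D')
  rcases Nat.lt_or_ge (rk M (D'.erase x)) (rk M D') with hlt | hge
  · omega
  · exfalso
    have heq : rk M (insert x (D'.erase x)) = rk M (D'.erase x) := by rw [insert_erase hx]; omega
    have h3 : x ∈ clF M (D'.erase x) := (mem_clF_iff_rk_insert_eq hxg ((erase_subset x D').trans hD'g)).2 heq
    have h4 : x ∈ clF M (D.erase x) := clF_mono_fu (erase_subset_erase x hD') h3
    have h5 := (mem_clF_iff_rk_insert_eq hxg ((erase_subset x D).trans hD)).1 h4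
    rw [insert_erase (hD' hx)] at h5
    omega

/-- If `g ∉ cl B'` and `x ∉ cl (B' ∪ g)` for an independent `B'`, then `g ∉ cl (B' ∪ x)`. -/
theorem notMem_clF_insert_of_notMem_clF_insert {g x : α} (hg : g ∈ gr M) (hx : x ∈ gr M) {B' : Finset α}
    (hB' : B' ⊆ gr M) (hB'r : rk M B' = B'.card) (hgB' : g ∉ B') (hgcl : g ∉ clF M B') (hxB' : x ∉ B')
    (hxcl : x ∉ clF M (insert g B')) : g ∉ clF M (insert x B') := by
  intro h
  have h1 : rk M (insert g B') = (insert g B').card := rk_insert_eq_card_of_notMem_clF hg hB' hB'r hgB' hgcl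
  rw [card_insert_of_notMem hgB'] at h1
  have hxg' : x ∉ insert g B' := by
    rw [mem_insert, not_or]; exact ⟨fun hxg => hxcl (hxg ▸ subset_clF_fu (insert_subset hg hB') (mem_insert_self g B')), hxB'⟩
  have h2 : rk M (insert x (insert g B')) = (insert x (insert g B')).card :=
    rk_insert_eq_card_of_notMem_clF hx (insert_subset hg hB') (by rw [h1, card_insert_of_notMem hgB']) hxg' hxcl
  rw [card_insert_of_notMem hxg', card_insert_of_notMem hgB'] at h2
  rw [mem_clF_iff_rk_insert_eq hg (insert_subset hx hB'), insert_comm] at h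
  have h3 := rk_le_card (M := M) (insert x B')
  rw [card_insert_of_notMem hxB'] at h3
  omega

/-! ### The signed sum as a difference of counts, on `2r − 2` points -/

/-- On `2r − 2` points every term of the signed sum is `[Z ∈ posTwo] − [Z ∈ negTwo]`. -/
theorem term_eq_of_mem_sepSets_two_mul {F₀ : Finset α} (hF : IsFlatF M F₀)
    (hN : (gr M).card + 2 = 2 * rk M (gr M)) {Z : Finset α} (hZ : Z ∈ sepSets M (principalUp M F₀)) :
    2 * (Z.card : ℤ) - (gr M).card - 1 =
      (if Z ∈ posTwo M F₀ then 1 else 0 : ℤ) - (if Z ∈ negTwo M F₀ then 1 else 0) := by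
  have hN' : ((gr M).card : ℤ) + 2 = 2 * rk M (gr M) := by exact_mod_cast hN
  rcases card_of_mem_sepSets_principal_two_mul hF hN hZ with h | h
  · have hn : Z ∈ negTwo M F₀ := mem_negTwo.2 ⟨hZ, h⟩
    have hp : Z ∉ posTwo M F₀ := fun hp => by have := (mem_posTwo.1 hp).2; omega
    rw [if_neg hp, if_pos hn]
    have h' : (Z.card : ℤ) + 1 = rk M (gr M) := by exact_mod_cast h
    linarith
  · have hp : Z ∈ posTwo M F₀ := mem_posTwo.2 ⟨hZ, h⟩
    have hn : Z ∉ negTwo M F₀ := fun hn => by have := (mem_negTwo.1 hn).2; omega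
    rw [if_pos hp, if_neg hn]
    have h' : (Z.card : ℤ) = rk M (gr M) := by exact_mod_cast h
    linarith

/-- The signed sum over a subfamily of the separated sets is `#(positive part) − #(negative part)`. -/
theorem sum_term_eq_of_subset {F₀ : Finset α} (hF : IsFlatF M F₀) (hN : (gr M).card + 2 = 2 * rk M (gr M))
    {S : Finset (Finset α)} (hS : S ⊆ sepSets M (principalUp M F₀)) :
    ∑ Z ∈ S, (2 * (Z.card : ℤ) - (gr M).card - 1) =
      ((S.filter (fun Z => Z ∈ posTwo M F₀)).card : ℤ) - (S.filter (fun Z => Z ∈ negTwo M F₀)).card := by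
  rw [sum_congr rfl (fun Z hZ => term_eq_of_mem_sepSets_two_mul hF hN (hS hZ)), sum_sub_distrib, sum_boole,
    sum_boole]

/-! ### The swap `Z ↦ (E ∖ Z) ∪ f` -/

/-- The complement of `(E ∖ Z) ∪ f` is `Z ∖ f` (`Z ⊆ E`). -/
theorem sdiff_insert_sdiff_eq_erase_line {Z : Finset α} (hZg : Z ⊆ gr M) (f : α) :
    gr M \ insert f (gr M \ Z) = Z.erase f := by
  rw [sdiff_insert, Finset.sdiff_sdiff_eq_self hZg]

/-- The swap is injective on sets containing `f`. -/
theorem eq_of_insert_sdiff_eq {Z₁ Z₂ : Finset α} (h₁ : Z₁ ⊆ gr M) (h₂ : Z₂ ⊆ gr M) {f : α} (hf₁ : f ∈ Z₁)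
    (hf₂ : f ∈ Z₂) (h : insert f (gr M \ Z₁) = insert f (gr M \ Z₂)) : Z₁ = Z₂ := by
  have h' : gr M \ insert f (gr M \ Z₁) = gr M \ insert f (gr M \ Z₂) := by rw [h]
  rw [sdiff_insert_sdiff_eq_erase_line h₁ f, sdiff_insert_sdiff_eq_erase_line h₂ f] at h'
  rw [← insert_erase hf₁, ← insert_erase hf₂, h']

/-- For a negative `Z ∋ f` whose complement does not span `f ∈ F₀`, the swap `(E ∖ Z) ∪ f` is positive. -/
theorem insert_sdiff_mem_posTwo {F₀ : Finset α} (hF : IsFlatF M F₀) (hN : (gr M).card + 2 = 2 * rk M (gr M))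
    {f : α} (hfF : f ∈ F₀) {Z : Finset α} (hZ : Z ∈ negTwo M F₀) (hfZ : f ∈ Z)
    (hfcl : f ∉ clF M (gr M \ Z)) : insert f (gr M \ Z) ∈ posTwo M F₀ := by
  obtain ⟨hZs, hc⟩ := mem_negTwo.1 hZ
  obtain ⟨_, _, hsum⟩ := bounds_of_mem_sepSets_principal hF hZs
  obtain ⟨hZg, hZr, hZcr⟩ := mem_biIndepAll.1 (mem_sepSets.1 hZs).1
  have hfg : f ∈ gr M := hZg hfZ
  have hfnot : f ∉ gr M \ Z := fun h => (mem_sdiff.1 h).2 hfZ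
  have hW : rk M (insert f (gr M \ Z)) = (insert f (gr M \ Z)).card :=
    rk_insert_eq_card_of_notMem_clF hfg sdiff_subset hZcr hfnot hfcl
  have hWc : (insert f (gr M \ Z)).card = rk M (gr M) := by rw [card_insert_of_notMem hfnot]; omega
  have hcomp := sdiff_insert_sdiff_eq_erase_line hZg f
  have hfcl' : f ∉ clF M (Z.erase f) := notMem_clF_erase_of_rk_eq_card hfg hZg hZr hfZ
  rw [mem_posTwo, mem_sepSets, mem_biIndepAll]
  refine ⟨⟨⟨insert_subset hfg sdiff_subset, hW, ?_⟩, ?_, ?_⟩, hWc⟩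
  · rw [hcomp]; exact rk_eq_card_of_subset_of_rk_eq_card (erase_subset f Z) hZr
  · have hr : rk M (insert f (gr M \ Z)) = rk M (gr M) := by rw [hW, hWc]
    rw [clF_eq_gr_of_rk_eq (insert_subset hfg sdiff_subset) hr]
    exact (mem_principalUp).2 ⟨Subset.refl _, ⟨Subset.refl _, Subset.antisymm (clF_subset_gr_fu _)
      (subset_clF_fu (Subset.refl _))⟩, hF.1⟩
  · rw [hcomp]
    intro hcon
    rw [mem_principalUp] at hcon
    exact hfcl' (hcon.2.2 hfF)

/-! ### The classes -/

/-- The negative sets of the class `(B)` of `e` (`e ∉ Z`). -/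
noncomputable def negB (M : Matroid α) [M.Finite] (F₀ : Finset α) (e : α) : Finset (Finset α) :=
  (sepB M (principalUp M F₀) e).filter (fun Z => Z ∈ negTwo M F₀)

/-- The positive sets of the class `(B)` of `e`. -/
noncomputable def posB (M : Matroid α) [M.Finite] (F₀ : Finset α) (e : α) : Finset (Finset α) :=
  (sepB M (principalUp M F₀) e).filter (fun Z => Z ∈ posTwo M F₀)

/-- The negative sets of the class `(D)` of `e` (`e ∈ Z`, `e ∈ cl (E ∖ Z)`). -/
noncomputable def negD (M : Matroid α) [M.Finite] (F₀ : Finset α) (e : α) : Finset (Finset α) :=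
  (sepD M (principalUp M F₀) e).filter (fun Z => Z ∈ negTwo M F₀)

/-- The positive sets of the class `(D)` of `e`. -/
noncomputable def posD (M : Matroid α) [M.Finite] (F₀ : Finset α) (e : α) : Finset (Finset α) :=
  (sepD M (principalUp M F₀) e).filter (fun Z => Z ∈ posTwo M F₀)

/-- `both`: the negative sets containing `F₀` whose complement spans neither `e` nor `f`. -/
noncomputable def bothL (M : Matroid α) [M.Finite] (F₀ : Finset α) (e f : α) : Finset (Finset α) :=
  (negTwo M F₀).filter (fun Z => F₀ ⊆ Z ∧ e ∉ clF M (gr M \ Z) ∧ f ∉ clF M (gr M \ Z))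

/-- `dep`: the positive sets containing `F₀` whose complement spans neither `e` nor `f` while
`(E ∖ B) ∪ F₀` has rank `r − 1`. -/
noncomputable def depL (M : Matroid α) [M.Finite] (F₀ : Finset α) (e f : α) : Finset (Finset α) :=
  (posTwo M F₀).filter (fun B => F₀ ⊆ B ∧ e ∉ clF M (gr M \ B) ∧ f ∉ clF M (gr M \ B) ∧
    rk M ((gr M \ B) ∪ F₀) + 1 = rk M (gr M))

/-- Membership in `bothL`. -/
theorem mem_bothL {F₀ Z : Finset α} {e f : α} : Z ∈ bothL M F₀ e f ↔
    Z ∈ negTwo M F₀ ∧ F₀ ⊆ Z ∧ e ∉ clF M (gr M \ Z) ∧ f ∉ clF M (gr M \ Z) := by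
  unfold bothL; rw [mem_filter]

/-- Membership in `depL`. -/
theorem mem_depL {F₀ B : Finset α} {e f : α} : B ∈ depL M F₀ e f ↔
    B ∈ posTwo M F₀ ∧ F₀ ⊆ B ∧ e ∉ clF M (gr M \ B) ∧ f ∉ clF M (gr M \ B) ∧
      rk M ((gr M \ B) ∪ F₀) + 1 = rk M (gr M) := by
  unfold depL; rw [mem_filter]

/-! ### The two injections by the swap at `f` -/

/-- `negB ↪ posD ∪ dep` by the swap `Z ↦ (E ∖ Z) ∪ f`. -/
theorem card_negB_le {F₀ : Finset α} (hF : IsFlatF M F₀) (hN : (gr M).card + 2 = 2 * rk M (gr M)) {e f : α}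
    (hF₀ : F₀ = {e, f}) :
    (negB M F₀ e).card ≤ (posD M F₀ e).card + (depL M F₀ e f).card := by
  subst hF₀
  have heF : e ∈ ({e, f} : Finset α) := mem_insert_self e {f}
  have hfF : f ∈ ({e, f} : Finset α) := mem_insert_of_mem (mem_singleton_self f)
  -- the facts of a member of `negB`
  have key : ∀ Z ∈ negB M {e, f} e, Z ∈ negTwo M {e, f} ∧ Z ⊆ gr M ∧ e ∉ Z ∧ e ∈ clF M Z ∧ f ∈ Z ∧
      f ∉ clF M (gr M \ Z) := by
    intro Z hZ
    unfold negB at hZ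
    rw [mem_filter] at hZ
    obtain ⟨hZB, hZn⟩ := hZ
    unfold sepB at hZB
    rw [mem_filter] at hZB
    obtain ⟨hZs, heZ, hecl⟩ := hZB
    obtain ⟨_, hout⟩ := subset_clF_of_mem_sepSets_principal hZs
    have hZg : Z ⊆ gr M := (mem_biIndepAll.1 (mem_sepSets.1 hZs).1).1
    have heg : e ∈ gr M := hF.1 heF
    have hfg : f ∈ gr M := hF.1 hfF
    have hesd : e ∈ gr M \ Z := mem_sdiff.2 ⟨heg, heZ⟩
    have hfZ : f ∈ Z := by
      by_contra hfZ
      apply hout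
      rw [insert_subset_iff, singleton_subset_iff]
      exact ⟨subset_clF_fu sdiff_subset hesd, subset_clF_fu sdiff_subset (mem_sdiff.2 ⟨hfg, hfZ⟩)⟩
    have hfcl : f ∉ clF M (gr M \ Z) := by
      intro h
      apply hout
      rw [insert_subset_iff, singleton_subset_iff]
      exact ⟨subset_clF_fu sdiff_subset hesd, h⟩
    exact ⟨hZn, hZg, heZ, hecl, hfZ, hfcl⟩
  calc (negB M {e, f} e).card ≤ (posD M {e, f} e ∪ depL M {e, f} e f).card := ?_
    _ ≤ (posD M {e, f} e).card + (depL M {e, f} e f).card := card_union_le _ _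
  apply card_le_card_of_injOn (fun Z => insert f (gr M \ Z))
  · intro Z hZ
    rw [mem_coe] at hZ
    obtain ⟨hZn, hZg, heZ, hecl, hfZ, hfcl⟩ := key Z hZ
    have hW := insert_sdiff_mem_posTwo hF hN hfF hZn hfZ hfcl
    have hcomp := sdiff_insert_sdiff_eq_erase_line hZg f
    have heg : e ∈ gr M := hF.1 heF
    have hfg : f ∈ gr M := hF.1 hfF
    have heW : e ∈ insert f (gr M \ Z) := mem_insert_of_mem (mem_sdiff.2 ⟨heg, heZ⟩)
    have hZr : rk M Z = Z.card := (mem_biIndepAll.1 (mem_sepSets.1 (mem_negTwo.1 hZn).1).1).2.1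
    have hfcl' : f ∉ clF M (Z.erase f) := notMem_clF_erase_of_rk_eq_card hfg hZg hZr hfZ
    rw [mem_coe, mem_union]
    by_cases hecl' : e ∈ clF M (Z.erase f)
    · left
      unfold posD sepD
      rw [mem_filter, mem_filter, hcomp]
      exact ⟨⟨(mem_posTwo.1 hW).1, heW, hecl'⟩, hW⟩
    · right
      rw [mem_depL, hcomp]
      refine ⟨hW, ?_, hecl', hfcl', ?_⟩
      · rw [insert_subset_iff, singleton_subset_iff]; exact ⟨heW, mem_insert_self f _⟩
      · have hunion : Z.erase f ∪ {e, f} = insert e Z := by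
          ext y
          simp only [mem_union, mem_erase, mem_insert, mem_singleton]
          constructor
          · rintro (⟨_, hy⟩ | hy | hy)
            · exact Or.inr hy
            · exact Or.inl hy
            · exact Or.inr (hy ▸ hfZ)
          · rintro (hy | hy)
            · exact Or.inr (Or.inl hy)
            · by_cases hyf : y = f
              · exact Or.inr (Or.inr hyf)
              · exact Or.inl ⟨hyf, hy⟩
        rw [hunion, (mem_clF_iff_rk_insert_eq heg hZg).1 hecl, hZr]
        exact (mem_negTwo.1 hZn).2
  · intro Z₁ hZ₁ Z₂ hZ₂ heq
    rw [mem_coe] at hZ₁ hZ₂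
    obtain ⟨_, h₁g, _, _, hf₁, _⟩ := key Z₁ hZ₁
    obtain ⟨_, h₂g, _, _, hf₂, _⟩ := key Z₂ hZ₂
    exact eq_of_insert_sdiff_eq h₁g h₂g hf₁ hf₂ heq

/-- `both ∪ negD ↪ posB` by the swap `Z ↦ (E ∖ Z) ∪ f`. -/
theorem card_bothL_union_negD_le {F₀ : Finset α} (hF : IsFlatF M F₀) (hN : (gr M).card + 2 = 2 * rk M (gr M))
    {e f : α} (hef : e ≠ f) (hF₀ : F₀ = {e, f}) :
    (bothL M F₀ e f ∪ negD M F₀ e).card ≤ (posB M F₀ e).card := by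
  subst hF₀
  have heF : e ∈ ({e, f} : Finset α) := mem_insert_self e {f}
  have hfF : f ∈ ({e, f} : Finset α) := mem_insert_of_mem (mem_singleton_self f)
  have heg : e ∈ gr M := hF.1 heF
  have hfg : f ∈ gr M := hF.1 hfF
  -- the facts of a member of `both ∪ negD`
  have key : ∀ Z ∈ bothL M {e, f} e f ∪ negD M {e, f} e, Z ∈ negTwo M {e, f} ∧ Z ⊆ gr M ∧ e ∈ Z ∧ f ∈ Z ∧
      f ∉ clF M (gr M \ Z) := by
    intro Z hZ
    rw [mem_union] at hZ
    rcases hZ with hZ | hZ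
    · rw [mem_bothL] at hZ
      obtain ⟨hZn, hsub, _, hfcl⟩ := hZ
      have hZg : Z ⊆ gr M := (mem_biIndepAll.1 (mem_sepSets.1 (mem_negTwo.1 hZn).1).1).1
      rw [insert_subset_iff, singleton_subset_iff] at hsub
      exact ⟨hZn, hZg, hsub.1, hsub.2, hfcl⟩
    · unfold negD at hZ
      rw [mem_filter] at hZ
      obtain ⟨hZD, hZn⟩ := hZ
      unfold sepD at hZD
      rw [mem_filter] at hZD
      obtain ⟨hZs, heZ, hecl⟩ := hZD
      obtain ⟨_, hout⟩ := subset_clF_of_mem_sepSets_principal hZs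
      have hZg : Z ⊆ gr M := (mem_biIndepAll.1 (mem_sepSets.1 hZs).1).1
      have hfcl : f ∉ clF M (gr M \ Z) := by
        intro h
        apply hout
        rw [insert_subset_iff, singleton_subset_iff]
        exact ⟨hecl, h⟩
      have hfZ : f ∈ Z := by
        by_contra hfZ
        exact hfcl (subset_clF_fu sdiff_subset (mem_sdiff.2 ⟨hfg, hfZ⟩))
      exact ⟨hZn, hZg, heZ, hfZ, hfcl⟩
  apply card_le_card_of_injOn (fun Z => insert f (gr M \ Z))
  · intro Z hZ
    rw [mem_coe] at hZ
    obtain ⟨hZn, hZg, heZ, hfZ, hfcl⟩ := key Z hZ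
    have hW := insert_sdiff_mem_posTwo hF hN hfF hZn hfZ hfcl
    have hWs : insert f (gr M \ Z) ∈ sepSets M (principalUp M {e, f}) := (mem_posTwo.1 hW).1
    have hWr : rk M (insert f (gr M \ Z)) = rk M (gr M) := by
      have := mem_biIndepAll.1 (mem_sepSets.1 hWs).1
      rw [this.2.1, (mem_posTwo.1 hW).2]
    rw [mem_coe]
    unfold posB sepB
    rw [mem_filter, mem_filter]
    refine ⟨⟨hWs, ?_, ?_⟩, hW⟩
    · rw [mem_insert, mem_sdiff, not_or, not_and, not_not]
      exact ⟨hef, fun _ => heZ⟩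
    · rw [clF_eq_gr_of_rk_eq (insert_subset hfg sdiff_subset) hWr]; exact heg
  · intro Z₁ hZ₁ Z₂ hZ₂ heq
    rw [mem_coe] at hZ₁ hZ₂
    obtain ⟨_, h₁g, _, hf₁, _⟩ := key Z₁ hZ₁
    obtain ⟨_, h₂g, _, hf₂, _⟩ := key Z₂ hZ₂
    exact eq_of_insert_sdiff_eq h₁g h₂g hf₁ hf₂ heq

/-- `both` and `negD` are disjoint (`e ∉ cl (E ∖ Z)` against `e ∈ cl (E ∖ Z)`). -/
theorem disjoint_bothL_negD {F₀ : Finset α} {e f : α} : Disjoint (bothL M F₀ e f) (negD M F₀ e) := by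
  rw [disjoint_left]
  intro Z h₁ h₂
  rw [mem_bothL] at h₁
  unfold negD sepD at h₂
  rw [mem_filter, mem_filter] at h₂
  exact h₁.2.2.1 h₂.1.2.2

/-- With a coloop `y ∈ F₀`, every negative set is in the class `(C)` of `y`, and the 114th module's injection
applies. -/
theorem card_negTwo_le_card_posTwo_of_coloop_mem {F₀ : Finset α} (hF : IsFlatF M F₀)
    (hN : (gr M).card + 2 = 2 * rk M (gr M)) {y : α} (hyF : y ∈ F₀)
    (hco : rk M ((gr M).erase y) + 1 = rk M (gr M)) : (negTwo M F₀).card ≤ (posTwo M F₀).card := by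
  have hy : y ∈ gr M := hF.1 hyF
  have h1 : negTwo M F₀ ⊆ negC M F₀ y := by
    intro Z hZ
    obtain ⟨hZs, hc⟩ := mem_negTwo.1 hZ
    obtain ⟨hin, _⟩ := subset_clF_of_mem_sepSets_principal hZs
    have hZg : Z ⊆ gr M := (mem_biIndepAll.1 (mem_sepSets.1 hZs).1).1
    have hyZ : y ∈ Z := by
      by_contra hyZ
      exact notMem_clF_of_coloop hy hco (fun z hz => mem_erase.2 ⟨fun h => hyZ (h ▸ hz), hZg hz⟩) (hin hyF)
    unfold negC sepC
    rw [mem_filter, mem_filter]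
    refine ⟨⟨hZs, hyZ, ?_⟩, hc⟩
    exact notMem_clF_of_coloop hy hco (fun z hz => mem_erase.2 ⟨fun h => (mem_sdiff.1 hz).2 (h ▸ hyZ),
      (mem_sdiff.1 hz).1⟩)
  have h2 : posC M F₀ y ⊆ posTwo M F₀ := by
    intro Z hZ
    unfold posC sepC at hZ
    rw [mem_filter, mem_filter] at hZ
    exact mem_posTwo.2 ⟨hZ.1.1, hZ.2⟩
  exact (card_le_card h1).trans ((card_negC_le_card_posC hF hN hyF).trans (card_le_card h2))

end PercRepro.Cogirth
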